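import Summits.HodgeConjecture.HodgeCM.Model.ToyG2.DescentFacts3_1

/-! PORT of `HodgeCM/Model/ToyG2/DescentFacts3.lean` (HodgeCMPerL run 82) — part 2: continuation of `Summits.HodgeConjecture.HodgeCM.Model.ToyG2.DescentFacts3_1` (split at a top-level declaration boundary by port_pkg.py; scope re-opened below; declarations unchanged). -/

-- port_pkg: scope re-opened for this part (file-level context, then the namespace/section stack open at the cut)
noncomputable section
open scoped TensorProduct
open exteriorPower Module
open Literature.AlgebraicGeometry.Motives
open Literature.AlgebraicGeometry.Motives.HodgeStructure (ofRat ofRat_apply mem_hodgeClasses_iff)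
namespace HodgeCM.ToyG2
open HodgeCM.Toy
variable (D : HodgeData) (T : TraceSys) (pl : GBlocks)
namespace GysinWitness₃
variable {T pl}
section Witness
variable {F : CMField} {n m : ℕ} (Ξ : Fin (n + 1 + (m + 1)) → CMType F)
  {pA : (TM₃ T pl).Mor ((TM₃ T pl).cmProd F Ξ) ((TM₃ T pl).cmProd F (blkA Ξ))}
  {pB : (TM₃ T pl).Mor ((TM₃ T pl).cmProd F Ξ) ((TM₃ T pl).cmProd F (blkB Ξ))}
/-- **(b)**: `p_Y^* e ∪ p_{Y'}^* ω ∈ Alg^{p+d'}(P) ⇒ e ∈ Alg^p(Y)` — decompose `Θ e = f + g` along `FF^{p} ⊕ GG^{p}`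
(`Obj.FF_sup_GG`); `g = 0` by steps 1 and 2, so `Θ e = f ∈ FF^{p}`, i.e. `e` is a Hodge class.  (Generation 1's
`GysinWitness.descent_b`, re-proved at the expanded objects and cut into `wedge_map_add₃`, `descent_b₃_sum_mem_FF`,
`descent_b₃_wedge_eq_zero`, `descent_b₃_g_eq_zero` so that every declaration elaborates within `maxHeartbeats ≤ 400000`,
the package policy of `CONTRIBUTING.md` §3 — generation 1 used one declaration at 1600000.) -/
theorem descent_b₃ (M : (TM₃ T pl).ModelAxioms) (hP : (TM₃ T pl).IsBlockPair F Ξ pA pB)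
    {ω : (TM₃ T pl).Coh ((TM₃ T pl).cmProd F (blkB Ξ)) (2 * (TM₃ T pl).dim ((TM₃ T pl).cmProd F (blkB Ξ)))}
    (hω : ω ≠ 0) (p : ℕ) (e : (TM₃ T pl).Coh ((TM₃ T pl).cmProd F (blkA Ξ)) (2 * p))
    (he : (TM₃ T pl).castCoh ((TM₃ T pl).cmProd F Ξ)
      (by omega : 2 * p + 2 * (TM₃ T pl).dim ((TM₃ T pl).cmProd F (blkB Ξ)) =
        2 * (p + (TM₃ T pl).dim ((TM₃ T pl).cmProd F (blkB Ξ))))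
      ((TM₃ T pl).cup ((TM₃ T pl).cmProd F Ξ) (2 * p) _ ((TM₃ T pl).pull pA (2 * p) e) ((TM₃ T pl).pull pB _ ω)) ∈
        (TM₃ T pl).alg ((TM₃ T pl).cmProd F Ξ) (p + (TM₃ T pl).dim ((TM₃ T pl).cmProd F (blkB Ξ)))) :
    e ∈ (TM₃ T pl).alg ((TM₃ T pl).cmProd F (blkA Ξ)) p := by
  obtain ⟨f, hf, g, hg, hfg⟩ := Submodule.mem_sup.mp
    (show ((TM₃ T pl).cmProd F (blkA Ξ)).X.toObj.Θ (2 * p) (ofRat e) ∈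
        ((TM₃ T pl).cmProd F (blkA Ξ)).X.toObj.FF (2 * p) p ⊔ ((TM₃ T pl).cmProd F (blkA Ξ)).X.toObj.GG (2 * p) p by
      rw [Obj.FF_sup_GG]; exact Submodule.mem_top)
  have hg0 : g = 0 :=
    descent_b₃_g_eq_zero Ξ M hP hω p hg (descent_b₃_wedge_eq_zero Ξ M p hf hg (descent_b₃_sum_mem_FF Ξ p e he hfg))
  rw [mem_hodgeClasses_iff]
  change ofRat e ∈ ((TM₃ T pl).cmProd F (blkA Ξ)).X.toObj.hodgeF _ _
  rw [Obj.mem_hodgeF, ← hfg, hg0, add_zero]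
  exact hf

end Witness

end GysinWitness₃

open GysinWitness₃ in
/-- **F7d `Fact_gysinDescent` holds in `toyModel3With exteriorHodgeData T pl`** (given its model axioms). -/
theorem fact3_gysinDescent (M : (toyModel3With exteriorHodgeData T pl).ModelAxioms) :
    (toyModel3With exteriorHodgeData T pl).Fact_gysinDescent := fun _F _n _m Ξ _pA _pB hP _ω hω =>
  ⟨fun k _e he => match k with
    | 0 => descent_a_zero₃ Ξ M hP hω he
    | _ + 1 => descent_a_succ₃ Ξ M hP hω he,
   fun p e he => descent_b₃ Ξ M hP hω p e he⟩

/-- **F7d-B `Fact_gysinDescentB` holds in `toyModel3With exteriorHodgeData T pl`** (given its model axioms). -/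
theorem fact3_gysinDescentB (M : (toyModel3With exteriorHodgeData T pl).ModelAxioms) :
    (toyModel3With exteriorHodgeData T pl).Fact_gysinDescentB :=
  Universe.gysinDescentB_of_gysinDescent (fact3_gysinDescent T pl M)

/-! ### The complete binder lists in `toyUniverse₃ d t` -/

section ToyUniverse

variable (d t : ℚ)

/-- **The TEN binders of `Assembly.COR_CM_of_descentFactsB₄` hold together in `toyUniverse₃ d t`** (`1 ≤ d`, `t² = 16`,
given its model axioms): `ModelAxioms ∧ RealisationExistsFace ∧ N1 ∧ N2 ∧ F4 ∧ F5 ∧ F-H0 ∧ F7d-B ∧ Fact_dimProd`. -/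
theorem toyUniverse₃_descentFactsB₄ (hd : 1 ≤ d) (ht : t ^ 2 = 16) (M : (toyUniverse₃ d t).ModelAxioms) :
    (toyUniverse₃ d t).ModelAxioms ∧ (toyUniverse₃ d t).RealisationExistsFace ∧ (toyUniverse₃ d t).Fact_cupExterior ∧
      (toyUniverse₃ d t).Fact_cup_hodge ∧ (toyUniverse₃ d t).Fact_cupAlg ∧ (toyUniverse₃ d t).Fact_cupAssoc ∧
      (toyUniverse₃ d t).Fact_unitH0 ∧ (toyUniverse₃ d t).Fact_gysinDescentB ∧ (toyUniverse₃ d t).Fact_dimProd :=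
  ⟨M, ThetaUiso.realisationExistsFace₃ d t hd ht, fact3_cupExterior _ _ _, fact3_cup_hodge _ _, fact3_cupAlg _ _,
    fact3_cupAssoc _ _ _, fact3_unitH0 _ _ _, fact3_gysinDescentB _ _ M, fact3_dimProd _ _ _⟩

/-- **The ten binders of `Assembly.COR_CM_of_descentFacts₄`** (F7d form) in `toyUniverse₃ d t`:
`ModelAxioms ∧ RealisationExistsFace ∧ N1 ∧ N2 ∧ Fact_pull_H0_cmProd ∧ F4 ∧ F5 ∧ F7d ∧ Fact_dimProd`. -/
theorem toyUniverse₃_descentFacts₄ (hd : 1 ≤ d) (ht : t ^ 2 = 16) (M : (toyUniverse₃ d t).ModelAxioms) :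
    (toyUniverse₃ d t).ModelAxioms ∧ (toyUniverse₃ d t).RealisationExistsFace ∧ (toyUniverse₃ d t).Fact_cupExterior ∧
      (toyUniverse₃ d t).Fact_cup_hodge ∧ (toyUniverse₃ d t).Fact_pull_H0_cmProd ∧ (toyUniverse₃ d t).Fact_cupAlg ∧
      (toyUniverse₃ d t).Fact_cupAssoc ∧ (toyUniverse₃ d t).Fact_gysinDescent ∧ (toyUniverse₃ d t).Fact_dimProd :=
  ⟨M, ThetaUiso.realisationExistsFace₃ d t hd ht, fact3_cupExterior _ _ _, fact3_cup_hodge _ _,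
    fact3_pull_H0_cmProd _ _ _, fact3_cupAlg _ _, fact3_cupAssoc _ _ _, fact3_gysinDescent _ _ M, fact3_dimProd _ _ _⟩

/-- **Everything at once in `toyUniverse₃ d t`**: model axioms · both realisations · N1–N4 · F4, F5, F-H0, F7d, F7d-B,
`Fact_dimProd`, `Fact_pull_H0_cmProd` — the union of the binder lists of `COR_CM_of_descentFacts`, `…B`, `…₃`, `…B₃`,
`…₄`, `…B₄` (and of `perL_of_openInputs`' realisation input). -/
theorem toyUniverse₃_descentProfile (hd : 1 ≤ d) (ht : t ^ 2 = 16) (M : (toyUniverse₃ d t).ModelAxioms) :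
    (toyUniverse₃ d t).ModelAxioms ∧
      ((toyUniverse₃ d t).RealisationExistsPerL ∧ (toyUniverse₃ d t).RealisationExistsFace) ∧
      ((toyUniverse₃ d t).Fact_cupExterior ∧ (toyUniverse₃ d t).Fact_cup_hodge ∧ (toyUniverse₃ d t).Fact_pull_H0 ∧
        (toyUniverse₃ d t).Fact_hodge_F0) ∧
      ((toyUniverse₃ d t).Fact_cupAlg ∧ (toyUniverse₃ d t).Fact_cupAssoc ∧ (toyUniverse₃ d t).Fact_unitH0 ∧
        (toyUniverse₃ d t).Fact_gysinDescent ∧ (toyUniverse₃ d t).Fact_gysinDescentB ∧ (toyUniverse₃ d t).Fact_dimProd ∧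
        (toyUniverse₃ d t).Fact_pull_H0_cmProd) :=
  ⟨M, ⟨ThetaUiso.realisationExistsPerL₃ d t hd ht, ThetaUiso.realisationExistsFace₃ d t hd ht⟩,
    ⟨fact3_cupExterior _ _ _, fact3_cup_hodge _ _, fact3_pull_H0 _ _ _, fact3_hodge_F0 _ _⟩,
    ⟨fact3_cupAlg _ _, fact3_cupAssoc _ _ _, fact3_unitH0 _ _ _, fact3_gysinDescent _ _ M, fact3_gysinDescentB _ _ M,
      fact3_dimProd _ _ _, fact3_pull_H0_cmProd _ _ _⟩⟩

/-- The end-to-end theorem of the trace-free route RUN on the model: `HC_CM` of `toyUniverse₃ d t` by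
`Assembly.COR_CM_of_descentFactsB₄` with all ten binders supplied (of course `HC_CM` is also immediate in the model, where
`alg =` Hodge classes; the point is that the binder list is met). -/
theorem toyUniverse₃_hcCM_by_descentB₄ (hd : 1 ≤ d) (ht : t ^ 2 = 16) (M : (toyUniverse₃ d t).ModelAxioms) :
    (toyUniverse₃ d t).HC_CM :=
  Assembly.COR_CM_of_descentFactsB₄ _ M (ThetaUiso.realisationExistsFace₃ d t hd ht) (fact3_cupExterior _ _ _)
    (fact3_cup_hodge _ _) (fact3_cupAlg _ _) (fact3_cupAssoc _ _ _) (fact3_unitH0 _ _ _) (fact3_gysinDescentB _ _ M)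
    (fact3_dimProd _ _ _)

/-- **JOINT WITNESS of the trace-free route's hypothesis set, modulo M26**: displaying only the Gysin/adjunction
identity M26 of the unitary Picard modular surface of `toyUniverse₃ 1 4` (toy-g2 `toyUniverse₃_modelAxioms_of_gysin`),
ONE universe satisfies all ten binders of `Assembly.COR_CM_of_descentFactsB₄`, realisation included.  The unconditional
form is `HodgeCM.ToyG2.exists_descentFactsB₄_inputs` in `HodgeCM.Model.ToyG2.DescentFactsAll3`. -/
theorem exists_descentFactsB₄_inputs_of_gysin (h26 : (toyUniverse₃ 1 4).Fact_gysin_surface) :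
    ∃ U : Universe, U.ModelAxioms ∧ U.RealisationExistsFace ∧ U.Fact_cupExterior ∧ U.Fact_cup_hodge ∧ U.Fact_cupAlg ∧
      U.Fact_cupAssoc ∧ U.Fact_unitH0 ∧ U.Fact_gysinDescentB ∧ U.Fact_dimProd :=
  ⟨toyUniverse₃ 1 4, toyUniverse₃_descentFactsB₄ 1 4 le_rfl (by norm_num) (toyUniverse₃_modelAxioms_of_gysin 1 4 h26)⟩

end ToyUniverse

end HodgeCM.ToyG2

end
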